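import Literature.MathematicalPhysics.QuantumLattice.BoundedWilsonFlowLift
import Literature.MathematicalPhysics.QuantumLattice.TorusWilsonFlowExistence
import Mathlib.Analysis.Calculus.Deriv.Star
import Mathlib.Analysis.Calculus.Deriv.Mul
import Mathlib.Analysis.Calculus.MeanValue
import HarnessLib

/-!
# The Wilson action decreases along the Wilson flow (general gauge group)

Topic `Literature/MathematicalPhysics/QuantumLattice`; settles the debt "monotonicity of the Wilson
action" recorded under "Deliberately NOT here" in `LatticeWilsonFlow.lean`,
`BoundedWilsonFlowLift.lean` and `TorusWilsonFlowExistence.lean`, for the tree's GENERAL matrix flow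
(Lüscher's equation (1.4) `V̇_t(e) = −π_𝔤(Ω_e(V_t)) V_t(e)` for a matrix group `H ⊆ U(N)`, any
dimension `d`, any FINITE site type `R`, e.g. the discrete torus `R = ZMod L`). The `SU(n)`-only
version for the tree's other flow `QuantumFieldTheory.wilsonFlow` is
`QuantumFieldTheory.antitone_wilsonAction_wilsonFlow` (`QuantumFieldTheory/WilsonFlow.lean`); the
present file is its port to `QuantumLattice.IsWilsonFlowLine` / `matrixWilsonFlow` /
`energyDensity` / `flowedEnergy`, which is the flow the Yang–Mills route `FlowLineStateSpace`
quantifies over.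

**Source.** M. Lüscher, *Properties and uses of the Wilson flow in lattice QCD*, JHEP 08 (2010) 071,
arXiv:1006.4518 [Luscher2010], §1 p. 2, right after eq. (1.4): "from eq. (1.4) one immediately
concludes that the action `S_w(V_t)` is a monotonically decreasing function of `t`"; M. Lüscher,
*Trivializing maps, the Wilson flow and the HMC algorithm*, CMP 293 (2010) 899 [Luscher2010Trivializing],
eq. (4.30): `d/dt S_w(V_t) ≤ 0`. The flow is the gradient flow of `g₀² S_w = 2·∑_{unoriented p} Re tr(1 − V(p))`
for the bi-invariant metric `⟨X, Y⟩ = Re tr(X†Y)`; along a flow line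
`d/dt ∑_x E(V_t)(x) = −2 ∑_e ‖π_𝔤 Ω_e(V_t)‖²_F ≤ 0` (`E` = the tree's `energyDensity`, Lüscher's (3.1),
so that `∑_x E = 2·(tree Wilson action)`).

## Contents (theorems only; everything stated is proved; no named facts, no definitions)

Private helpers (folklore bookkeeping): `re_trace_plaquette_deriv` — the trace algebra of the
product rule for one plaquette `A₁ A₂ A₃† A₄†` with `Ȧ_k = −X_k A_k` (the real trace of the
derivative is minus the sum over the four links of `Re tr(X_k · loop starting with link k)`);
`sum_plaquette_link_terms` — the purely combinatorial re-indexing "sum over (plaquette, link ∈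
plaquette) = sum over (link, plaquette ∋ link)" on a finite lattice with commutative site group.

* `re_trace_mul_plaquetteSum` — expanding `Re tr(X · Ω_e(W))` over the `2(d−1)` loops through `e`.
* `re_trace_lieProjection_mul` — the gradient identity `Re tr(π_𝔤 W · W) = −Re tr((π_𝔤 W)† π_𝔤 W)`
  for `H ⊆ U(N)` (`π_𝔤 W` is skew-Hermitian and `⟨π_𝔤 W, W − π_𝔤 W⟩ = 0`).
* `hasDerivAt_sum_energyDensity` — `d/dt ∑_x E(Φ_t)(x) = −2 ∑_e Re tr((π_𝔤 Ω_e(Φ_t))† π_𝔤 Ω_e(Φ_t))`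
  along every flow line `Φ` of (1.4); `antitone_sum_energyDensity` — hence `t ↦ ∑_x E(Φ_t)(x)` is
  antitone on `ℝ`; `antitone_sum_energyDensity_matrixWilsonFlow` — the same for the tree's flow
  `matrixWilsonFlow H t V` of unitary data.
* Gauge-group level (`ρ : G →* M_N(ℂ)` unitary-valued): `antitone_sum_flowedEnergy`
  (`t ↦ ∑_x flowedEnergy ρ t x U`), `sum_flowedEnergy_le_two_mul_wilsonAction` (on the torus,
  `∑_x E_t(x) ≤ 2·wilsonAction ρ U` for `t ≥ 0`), and `antitone_sum_plaquetteEnergy_of_isWilsonFlowLine`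
  (the same sum written, as the route items do, through any `G`-valued torus flow line `B` with
  `ρ ∘ B` the matrix flow line of `ρ ∘ U`).

Design: no definitions — the "upper"/"lower" link terms of the `SU(n)` file are passed to the
combinatorial lemma as arbitrary functions `up lo : (Fin d → R) → Fin d → Fin d → ℝ`. Norms:
Frobenius (`Matrix.Norms.Frobenius`), the norm of the tree's `frobeniusInnerProductSpace` (used
only inside one proof, via `letI`, so no instance attribute is set in this file).

Deliberately NOT here: strict decrease off the stationary points, the group law, smoothness in the
data, gauge covariance (all as in the `SU(n)` file, not needed by the current consumers).

## References

* M. Lüscher, JHEP 08 (2010) 071, arXiv:1006.4518, eq. (1.4) and §1 p. 2. [Luscher2010]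
* M. Lüscher, Commun. Math. Phys. 293 (2010) 899–919, arXiv:0907.5491, eq. (4.30). [Luscher2010Trivializing]
-/

noncomputable section

open scoped Matrix.Norms.Frobenius
open Matrix

namespace Literature.MathematicalPhysics.QuantumLattice

/-! ### Trace algebra -/

section TraceAlgebra

variable {N : ℕ}

/-- `Re tr M† = Re tr M`. [folklore] -/
private theorem re_trace_conjTranspose_eq (M : Matrix (Fin N) (Fin N) ℂ) : Mᴴ.trace.re = M.trace.re := by
  rw [Matrix.trace_conjTranspose, Complex.star_def, Complex.conj_re]

/-- The trace algebra behind `d/dt Re tr V(p)`: the real trace of the product-rule derivative of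
`A₁ A₂ A₃† A₄†` with `Ȧₖ = −Xₖ Aₖ` is minus the sum over the four links of
`Re tr (Xₖ · loop starting with link k)` (ported verbatim from the tree's `SU(n)` file
`QuantumFieldTheory/WilsonFlow.lean`). [folklore] -/
private theorem re_trace_plaquette_deriv (X₁ X₂ X₃ X₄ A₁ A₂ A₃ A₄ : Matrix (Fin N) (Fin N) ℂ) :
    (((-X₁ * A₁ * A₂ + A₁ * (-X₂ * A₂)) * star A₃ + A₁ * A₂ * star (-X₃ * A₃)) * star A₄ +
        A₁ * A₂ * star A₃ * star (-X₄ * A₄)).trace.re =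
      -((X₁ * (A₁ * A₂ * A₃ᴴ * A₄ᴴ)).trace.re + (X₂ * (A₂ * A₃ᴴ * A₄ᴴ * A₁)).trace.re +
        (X₃ * (A₃ * A₂ᴴ * A₁ᴴ * A₄)).trace.re + (X₄ * (A₄ * A₃ * A₂ᴴ * A₁ᴴ)).trace.re) := by
  have T2 : (A₁ * (X₂ * (A₂ * (A₃ᴴ * A₄ᴴ)))).trace.re =
      (X₂ * (A₂ * (A₃ᴴ * (A₄ᴴ * A₁)))).trace.re := by
    rw [Matrix.trace_mul_comm]
    simp only [Matrix.mul_assoc]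
  have T3 : (A₁ * (A₂ * (A₃ᴴ * (X₃ᴴ * A₄ᴴ)))).trace.re =
      (X₃ * (A₃ * (A₂ᴴ * (A₁ᴴ * A₄)))).trace.re := by
    rw [← re_trace_conjTranspose_eq (A₁ * (A₂ * (A₃ᴴ * (X₃ᴴ * A₄ᴴ))))]
    simp only [Matrix.conjTranspose_mul, Matrix.conjTranspose_conjTranspose, Matrix.mul_assoc]
    rw [Matrix.trace_mul_comm]
    simp only [Matrix.mul_assoc]
  have T4 : (A₁ * (A₂ * (A₃ᴴ * (A₄ᴴ * X₄ᴴ)))).trace.re =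
      (X₄ * (A₄ * (A₃ * (A₂ᴴ * A₁ᴴ)))).trace.re := by
    rw [← re_trace_conjTranspose_eq (A₁ * (A₂ * (A₃ᴴ * (A₄ᴴ * X₄ᴴ))))]
    simp only [Matrix.conjTranspose_mul, Matrix.conjTranspose_conjTranspose, Matrix.mul_assoc]
  simp only [Matrix.star_eq_conjTranspose, Matrix.conjTranspose_mul, Matrix.conjTranspose_neg,
    Matrix.add_mul, neg_mul, mul_neg, Matrix.trace_add, Matrix.trace_neg, Complex.add_re,
    Complex.neg_re, Matrix.mul_assoc]
  rw [T2, T3, T4]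
  ring

open scoped ComplexOrder in
/-- `Re tr (A† A) ≥ 0`. [folklore] -/
private theorem re_trace_conjTranspose_mul_self_nonneg_aux (A : Matrix (Fin N) (Fin N) ℂ) :
    0 ≤ (Aᴴ * A).trace.re := by
  have h : 0 ≤ (Aᴴ * A).trace := (Matrix.posSemidef_conjTranspose_mul_self A).trace_nonneg
  exact (Complex.nonneg_iff.mp h).1

/-- **The gradient identity.** If `H ⊆ U(N)` then for every `W`,
`Re tr(π_𝔤 W · W) = −Re tr((π_𝔤 W)† π_𝔤 W) = −‖π_𝔤 W‖²_F`: `π_𝔤 W` is skew-Hermitian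
(`conjTranspose_lieProjection`), so `Re tr(π_𝔤 W · W) = −⟨π_𝔤 W, W⟩`, and
`⟨π_𝔤 W, W⟩ = ⟨π_𝔤 W, π_𝔤 W⟩` because `π_𝔤` is the orthogonal projection
(`inner_sub_lieProjection`). This is Lüscher's `∂ᵃ_{x,μ} S_w · ∂ᵃ_{x,μ} S_w ≥ 0` behind (4.30).
[cite: Luscher2010Trivializing, eq. (4.30)] -/
theorem re_trace_lieProjection_mul {H : Set (Matrix (Fin N) (Fin N) ℂ)}
    (hH : ∀ A ∈ H, A ∈ Matrix.unitaryGroup (Fin N) ℂ) (W : Matrix (Fin N) (Fin N) ℂ) :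
    (lieProjection H W * W).trace.re = -(((lieProjection H W)ᴴ * lieProjection H W).trace.re) := by
  letI : InnerProductSpace ℝ (Matrix (Fin N) (Fin N) ℂ) := frobeniusInnerProductSpace
  set X := lieProjection H W with hX
  have hskew : Xᴴ = -X := conjTranspose_lieProjection hH W
  have horth : inner ℝ X (W - X) = 0 := inner_sub_lieProjection (lieProjection_mem H W) W
  have h1 : inner ℝ X W = inner ℝ X X := by
    have : inner ℝ X W = inner ℝ X (W - X) + inner ℝ X X := by
      rw [← inner_add_right, sub_add_cancel]
    rw [this, horth, zero_add]
  rw [frobenius_inner_def, frobenius_inner_def] at h1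
  have h2 : (X * W).trace.re = -((Xᴴ * W).trace.re) := by
    rw [hskew, Matrix.neg_mul, Matrix.trace_neg, Complex.neg_re, neg_neg]
  rw [h2, h1]

end TraceAlgebra

/-! ### Combinatorics of the finite lattice -/

section Combinatorics

variable {d : ℕ} {R : Type*} [AddCommGroup R] [One R] [Fintype R]

omit [One R] in
/-- Translation invariance of sums over the finite lattice: `∑_x f(x + v) = ∑_x f(x)`. [folklore] -/
private theorem sum_comp_add_right (f : (Fin d → R) → ℝ) (v : Fin d → R) :
    ∑ x : Fin d → R, f (x + v) = ∑ x : Fin d → R, f x :=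
  Fintype.sum_equiv (Equiv.addRight v) _ _ fun _ => rfl

/-- Splitting an off-diagonal double sum over directions according to the order of the pair:
`∑_a ∑_{b ≠ a} g a b = ∑_{a<b} (g a b + g b a)`. [folklore] -/
private theorem sum_offDiag_eq_sum_lt_add (g : Fin d → Fin d → ℝ) :
    ∑ a : Fin d, ∑ b : Fin d, (if b = a then (0 : ℝ) else g a b) =
      ∑ a : Fin d, ∑ b : Fin d, (if a < b then g a b + g b a else 0) := by
  have hsplit : ∀ a b : Fin d, (if b = a then (0 : ℝ) else g a b) =
      (if a < b then g a b else 0) + (if b < a then g a b else 0) := by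
    intro a b
    rcases lt_trichotomy a b with h | h | h
    · rw [if_neg (ne_of_gt h), if_pos h, if_neg (lt_asymm h), add_zero]
    · subst h
      simp
    · rw [if_neg (ne_of_lt h), if_neg (lt_asymm h), if_pos h, zero_add]
  simp only [hsplit, Finset.sum_add_distrib]
  have hswap : ∑ a : Fin d, ∑ b : Fin d, (if b < a then g a b else 0) =
      ∑ a : Fin d, ∑ b : Fin d, (if a < b then g b a else 0) := Finset.sum_comm
  rw [hswap, ← Finset.sum_add_distrib]
  refine Finset.sum_congr rfl fun a _ => ?_
  rw [← Finset.sum_add_distrib]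
  refine Finset.sum_congr rfl fun b _ => ?_
  split_ifs <;> simp

/-- **Re-indexing (plaquette, link) pairs.** For arbitrary "upper" and "lower" link terms
`up lo : site → direction → direction → ℝ` on a finite lattice with commutative site group: summing,
over the unoriented plaquettes `(x, μ < ν)`, the four link contributions
`up x μ ν + lo (x + μ̂) ν μ + lo (x + ν̂) μ ν + up x ν μ` equals summing, over the links `(x, μ)`,
the contributions `∑_{ν ≠ μ} (up x μ ν + lo x μ ν)` of the `2(d−1)` plaquettes through the link
(translation invariance of `∑_x` absorbs the shifts). [folklore] -/
private theorem sum_plaquette_link_terms (up lo : (Fin d → R) → Fin d → Fin d → ℝ) :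
    ∑ x : Fin d → R, ∑ μ : Fin d, ∑ ν : Fin d, (if μ < ν then
        up x μ ν + lo (x + Pi.single μ 1) ν μ + lo (x + Pi.single ν 1) μ ν + up x ν μ else 0) =
      ∑ x : Fin d → R, ∑ μ : Fin d, ∑ ν : Fin d,
        (if ν = μ then (0 : ℝ) else up x μ ν + lo x μ ν) := by
  -- bring the site sum inside and remove the shifts
  have hL : ∑ x : Fin d → R, ∑ μ : Fin d, ∑ ν : Fin d, (if μ < ν then
        up x μ ν + lo (x + Pi.single μ 1) ν μ + lo (x + Pi.single ν 1) μ ν + up x ν μ else 0) =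
      ∑ x : Fin d → R, ∑ μ : Fin d, ∑ ν : Fin d, (if μ < ν then
        (up x μ ν + lo x μ ν) + (up x ν μ + lo x ν μ) else 0) := by
    rw [Finset.sum_comm]
    conv_rhs => rw [Finset.sum_comm]
    refine Finset.sum_congr rfl fun μ _ => ?_
    rw [Finset.sum_comm]
    conv_rhs => rw [Finset.sum_comm]
    refine Finset.sum_congr rfl fun ν _ => ?_
    split_ifs with h
    · simp only [Finset.sum_add_distrib]
      rw [sum_comp_add_right (fun x => lo x ν μ) (Pi.single μ 1),
        sum_comp_add_right (fun x => lo x μ ν) (Pi.single ν 1)]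
      ring
    · rfl
  rw [hL]
  refine Finset.sum_congr rfl fun x _ => ?_
  rw [sum_offDiag_eq_sum_lt_add (fun a b => up x a b + lo x a b)]

end Combinatorics

/-! ### The derivative of the action along a flow line -/

section MatrixLevel

variable {d : ℕ} {R : Type*} [AddCommGroup R] [One R] {N : ℕ}

/-- Expanding `Ω_e`: `Re tr(X · Ω_e(W)) = ∑_{ν ≠ μ} [Re tr(X · upper loop) + Re tr(X · lower loop)]`.
[cite: Luscher2010, eqs. (1.3)–(1.4)] -/
theorem re_trace_mul_plaquetteSum (X : Matrix (Fin N) (Fin N) ℂ) (W : MatrixLinkField d R N)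
    (e : (Fin d → R) × Fin d) :
    (X * plaquetteSum W e).trace.re = ∑ ν : Fin d, if ν = e.2 then (0 : ℝ) else
      ((X * (W e * W (e.1 + Pi.single e.2 1, ν) * (W (e.1 + Pi.single ν 1, e.2))ᴴ *
          (W (e.1, ν))ᴴ)).trace.re +
        (X * (W e * (W (e.1 + Pi.single e.2 1 - Pi.single ν 1, ν))ᴴ *
          (W (e.1 - Pi.single ν 1, e.2))ᴴ * W (e.1 - Pi.single ν 1, ν))).trace.re) := by
  unfold plaquetteSum
  rw [Matrix.mul_sum, Matrix.trace_sum, Complex.re_sum]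
  refine Finset.sum_congr rfl fun ν _ => ?_
  split_ifs with h
  · rw [Matrix.mul_zero, Matrix.trace_zero, Complex.zero_re]
  · rw [Matrix.mul_add, Matrix.trace_add, Complex.add_re]

omit [One R] in
/-- `x + m + n − m = x + n` in the commutative site group. [folklore] -/
private theorem site_add_add_sub_cancel (x m n : Fin d → R) : x + m + n - m = x + n := by
  rw [add_right_comm, add_sub_cancel_right]

variable [Fintype R]

/-- **The Wilson flow is the gradient flow of the Wilson action** (general gauge group `H ⊆ U(N)`,
finite lattice): along every flow line `Φ` of Lüscher's equation (1.4),
`d/dt ∑_x E(Φ_t)(x) = −2 ∑_e Re tr((π_𝔤 Ω_e(Φ_t))† π_𝔤 Ω_e(Φ_t)) = −2 ∑_e ‖π_𝔤 Ω_e(Φ_t)‖²_F`,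
where `E` is the plaquette action density `energyDensity` (so `∑_x E = g₀² S_w`).
[cite: Luscher2010Trivializing, eq. (4.30)] -/
theorem hasDerivAt_sum_energyDensity {H : Set (Matrix (Fin N) (Fin N) ℂ)}
    (hH : ∀ A ∈ H, A ∈ Matrix.unitaryGroup (Fin N) ℂ) {V : MatrixLinkField d R N}
    {Φ : ℝ → MatrixLinkField d R N} (hΦ : IsWilsonFlowLine H V Φ) (t : ℝ) :
    HasDerivAt (fun s => ∑ x : Fin d → R, energyDensity (Φ s) x)
      (-(2 * ∑ e : (Fin d → R) × Fin d, ((lieProjection H (plaquetteSum (Φ t) e))ᴴ *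
        lieProjection H (plaquetteSum (Φ t) e)).trace.re)) t := by
  -- abbreviations: the skew fields `X_e` at time `t`, the link terms
  set X : (Fin d → R) × Fin d → Matrix (Fin N) (Fin N) ℂ :=
    fun e => lieProjection H (plaquetteSum (Φ t) e) with hX
  set up : (Fin d → R) → Fin d → Fin d → ℝ :=
    fun y a b => (X (y, a) * plaquetteMatrix (Φ t) y a b).trace.re with hup
  set lo : (Fin d → R) → Fin d → Fin d → ℝ := fun y a b =>
    (X (y, a) * (Φ t (y, a) * (Φ t (y + Pi.single a 1 - Pi.single b 1, b))ᴴ *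
      (Φ t (y - Pi.single b 1, a))ᴴ * Φ t (y - Pi.single b 1, b))).trace.re with hlo
  -- the links move by `Ẇ_e = −X_e W_e`
  have hlink : ∀ e : (Fin d → R) × Fin d,
      HasDerivAt (fun s => Φ s e) (-X e * Φ t e) t := fun e => by
    have h := hΦ.hasDerivAt t e
    simpa only [wilsonFlowField, wilsonFlowGenerator, neg_mul] using h
  -- one plaquette
  have hplaq : ∀ (x : Fin d → R) (μ ν : Fin d),
      HasDerivAt (fun s => (plaquetteMatrix (Φ s) x μ ν).trace.re)
        (-(up x μ ν + lo (x + Pi.single μ 1) ν μ + lo (x + Pi.single ν 1) μ ν + up x ν μ)) t := by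
    intro x μ ν
    have h := (((hlink (x, μ)).fun_mul (hlink (x + Pi.single μ 1, ν))).fun_mul
      (hlink (x + Pi.single ν 1, μ)).star).fun_mul (hlink (x, ν)).star
    have hfun : (fun s => plaquetteMatrix (Φ s) x μ ν) = fun s =>
        Φ s (x, μ) * Φ s (x + Pi.single μ 1, ν) * star (Φ s (x + Pi.single ν 1, μ)) *
          star (Φ s (x, ν)) := by
      funext s
      simp only [plaquetteMatrix, Matrix.star_eq_conjTranspose]
    have htr := Complex.reCLM.hasFDerivAt.comp_hasDerivAt t
      (((Matrix.traceLinearMap (Fin N) ℝ ℂ).toContinuousLinearMap.hasFDerivAt).comp_hasDerivAt t h)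
    rw [← hfun] at htr
    refine htr.congr_deriv ?_
    show (_ : Matrix (Fin N) (Fin N) ℂ).trace.re = _
    rw [re_trace_plaquette_deriv]
    simp only [hup, hlo, plaquetteMatrix, site_add_add_sub_cancel, add_sub_cancel_right]
  -- the whole action, plaquette by plaquette
  have hsum : HasDerivAt (fun s => ∑ x : Fin d → R, energyDensity (Φ s) x)
      (∑ x : Fin d → R, 2 * ∑ μ : Fin d, ∑ ν : Fin d, (if μ < ν then
        up x μ ν + lo (x + Pi.single μ 1) ν μ + lo (x + Pi.single ν 1) μ ν + up x ν μ else 0)) t := by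
    refine HasDerivAt.fun_sum fun x _ => ?_
    simp only [energyDensity]
    refine HasDerivAt.const_mul (2 : ℝ) (HasDerivAt.fun_sum fun μ _ => HasDerivAt.fun_sum fun ν _ => ?_)
    split_ifs with hμν
    · have h := (hplaq x μ ν).const_sub (N : ℝ)
      simp only [neg_neg] at h
      exact h
    · exact hasDerivAt_const t (0 : ℝ)
  refine hsum.congr_deriv ?_
  -- re-index (plaquette, link) pairs and recognise `Re tr(X_e Ω_e)`
  rw [← Finset.mul_sum, sum_plaquette_link_terms up lo, Fintype.sum_prod_type, neg_mul_eq_mul_neg]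
  congr 1
  simp only [← Finset.sum_neg_distrib]
  refine Finset.sum_congr rfl fun x _ => Finset.sum_congr rfl fun μ _ => ?_
  rw [← re_trace_lieProjection_mul hH, re_trace_mul_plaquetteSum]
  dsimp only
  refine Finset.sum_congr rfl fun ν _ => ?_
  split_ifs with h
  · rfl
  · simp only [hup, hlo, hX, plaquetteMatrix]

/-- `d/dt ∑_x E(Φ_t)(x) ≤ 0` along every flow line of (1.4) (`H ⊆ U(N)`).
[cite: Luscher2010Trivializing, eq. (4.30)] -/
theorem deriv_sum_energyDensity_nonpos {H : Set (Matrix (Fin N) (Fin N) ℂ)}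
    (hH : ∀ A ∈ H, A ∈ Matrix.unitaryGroup (Fin N) ℂ) {V : MatrixLinkField d R N}
    {Φ : ℝ → MatrixLinkField d R N} (hΦ : IsWilsonFlowLine H V Φ) (t : ℝ) :
    deriv (fun s => ∑ x : Fin d → R, energyDensity (Φ s) x) t ≤ 0 := by
  rw [(hasDerivAt_sum_energyDensity hH hΦ t).deriv, neg_nonpos]
  exact mul_nonneg zero_le_two
    (Finset.sum_nonneg fun e _ => re_trace_conjTranspose_mul_self_nonneg_aux _)

/-- **Monotonicity of the Wilson action along the Wilson flow** (Lüscher: "the action `S_w(V_t)`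
is a monotonically decreasing function of `t`"), general gauge group `H ⊆ U(N)`, finite lattice:
along every flow line `Φ` of (1.4), `t ↦ ∑_x E(Φ_t)(x)` is antitone on `ℝ`.
[cite: Luscher2010, §1 p. 2 (after eq. (1.4))] -/
theorem antitone_sum_energyDensity {H : Set (Matrix (Fin N) (Fin N) ℂ)}
    (hH : ∀ A ∈ H, A ∈ Matrix.unitaryGroup (Fin N) ℂ) {V : MatrixLinkField d R N}
    {Φ : ℝ → MatrixLinkField d R N} (hΦ : IsWilsonFlowLine H V Φ) :
    Antitone fun t => ∑ x : Fin d → R, energyDensity (Φ t) x :=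
  antitone_of_deriv_nonpos (fun t => (hasDerivAt_sum_energyDensity hH hΦ t).differentiableAt)
    fun t => deriv_sum_energyDensity_nonpos hH hΦ t

/-- **Monotonicity for the tree's flow `matrixWilsonFlow`**: for `H ⊆ U(N)` and unitary initial
link matrices `V` on a finite lattice, `t ↦ ∑_x E(matrixWilsonFlow H t V)(x)` is antitone (a flow
line exists, `exists_isWilsonFlowLine_of_unitary`, and `matrixWilsonFlow` is one).
[cite: Luscher2010, §1 p. 2 (after eq. (1.4))] -/
theorem antitone_sum_energyDensity_matrixWilsonFlow {H : Set (Matrix (Fin N) (Fin N) ℂ)}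
    (hH : ∀ A ∈ H, A ∈ Matrix.unitaryGroup (Fin N) ℂ) {V : MatrixLinkField d R N}
    (hV : ∀ e, V e ∈ Matrix.unitaryGroup (Fin N) ℂ) :
    Antitone fun t => ∑ x : Fin d → R, energyDensity (matrixWilsonFlow H t V) x :=
  antitone_sum_energyDensity hH
    (isWilsonFlowLine_matrixWilsonFlow (exists_isWilsonFlowLine_of_unitary hH hV))

end MatrixLevel

/-! ### Gauge-group level -/

section GroupLevel

variable {d : ℕ} {R : Type*} [AddCommGroup R] [One R] [Fintype R] {N : ℕ} {G : Type*} [Group G]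
variable (ρ : G →* Matrix (Fin N) (Fin N) ℂ)

/-- **The total flowed action density decreases along the Wilson flow**: for a unitary-valued
representation `ρ` and every configuration `U` on a finite lattice, `t ↦ ∑_x flowedEnergy ρ t x U`
is antitone on `ℝ`. [cite: Luscher2010, §1 p. 2 (after eq. (1.4))] -/
theorem antitone_sum_flowedEnergy (hρ : ∀ g, ρ g ∈ Matrix.unitaryGroup (Fin N) ℂ)
    (U : (Fin d → R) × Fin d → G) :
    Antitone fun t => ∑ x : Fin d → R, flowedEnergy ρ t x U := by
  have hH : ∀ A ∈ Set.range ρ, A ∈ Matrix.unitaryGroup (Fin N) ℂ := by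
    rintro _ ⟨g, rfl⟩
    exact hρ g
  have h := antitone_sum_energyDensity_matrixWilsonFlow (d := d) (R := R) hH
    (V := fun e => ρ (U e)) fun e => hρ (U e)
  simpa only [flowedEnergy_eq_energyDensity, wilsonFlowMatrix] using h

/-- On the torus, for unitary `ρ` and `t ≥ 0`: `∑_x E_t(x) ≤ ∑_x E_0(x) = 2 · wilsonAction ρ U` — the
flowed total action density never exceeds (twice) the Wilson action of the initial configuration.
[cite: Luscher2010, §1 p. 2 and eqs. (1.3), (3.1)] -/
theorem sum_flowedEnergy_le_two_mul_wilsonAction {L : ℕ} [NeZero L]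
    (hρ : ∀ g, ρ g ∈ Matrix.unitaryGroup (Fin N) ℂ)
    (U : Literature.MathematicalPhysics.QuantumFieldTheory.GaugeConfig d L G) {t : ℝ} (ht : 0 ≤ t) :
    ∑ x, flowedEnergy ρ t x U ≤
      2 * Literature.MathematicalPhysics.QuantumFieldTheory.wilsonAction ρ U := by
  rw [← sum_flowedEnergy_zero ρ hρ U]
  exact antitone_sum_flowedEnergy ρ hρ U ht

/-- **Monotonicity through a `G`-valued torus flow line** (the form quantified by the Yang–Mills
route `FlowLineStateSpace`): if `s ↦ ρ ∘ B s` is the matrix Wilson flow line of `ρ ∘ U` for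
unitary `ρ`, then the total plaquette energy
`τ ↦ ∑_x 2 ∑_{μ<ν} (N − Re tr ρ(U^{B τ}_{x,μν}))` is antitone on `ℝ`.
[cite: Luscher2010, §1 p. 2 (after eq. (1.4))] -/
theorem antitone_sum_plaquetteEnergy_of_isWilsonFlowLine {L : ℕ} [NeZero L]
    (hρ : ∀ g, ρ g ∈ Matrix.unitaryGroup (Fin N) ℂ)
    {U : Literature.MathematicalPhysics.QuantumFieldTheory.GaugeConfig d L G}
    {B : ℝ → Literature.MathematicalPhysics.QuantumFieldTheory.GaugeConfig d L G}
    (hB : IsWilsonFlowLine (Set.range ρ) (fun e => ρ (U e)) fun s e => ρ (B s e)) :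
    Antitone fun τ => ∑ x : Literature.MathematicalPhysics.QuantumFieldTheory.Site d L,
      (2 * ∑ μ : Fin d, ∑ ν : Fin d, if μ < ν then ((N : ℝ) -
        (ρ (Literature.MathematicalPhysics.QuantumFieldTheory.plaquetteHolonomy (B τ) x μ ν)).trace.re)
        else 0 : ℝ) := by
  have h := antitone_sum_flowedEnergy (d := d) (R := ZMod L) ρ hρ U
  refine fun τ₁ τ₂ hτ => ?_
  have h12 := h hτ
  simpa only [flowedEnergy_eq_of_isWilsonFlowLine ρ hρ hB] using h12

end GroupLevel

end Literature.MathematicalPhysics.QuantumLattice
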